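import Mathlib
import HarnessLib
import Summits.Ventures.LatticeQCDFlow.Scoring.KArmHomogeneityCoverage
import Summits.Ventures.LatticeQCDFlow.Scoring.GaussianNoncentralCochranReduction
import Summits.Ventures.LatticeQCDFlow.Scoring.GaussianShiftedBallMonotone
import Summits.Ventures.LatticeQCDFlow.Scoring.KArmHomogeneityPairwise

/-!
# THE LOCAL POWER OF THE `k`-ARM HOMOGENEITY TEST: UNDER CENTRES `a + h_r/√n` THE ACCEPTANCE
# PROBABILITY `P(Σ_r (Sₙ^r − m̂ₙ)²/V̂ₙ^r ≤ c)` TENDS TO THE SHIFTED-BALL PROBABILITY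
# `N(0,1)^{⊗R}{(z_1 + κ)² + Σ_{r ≠ 0, 1} z_r² ≤ c}`, `κ² = Σ_r (h_r − h̄_w)²/s_r`
# (textbook: non-central `χ²_{R−1}(κ²)`), WHICH IS NON-INCREASING IN `κ`

HONEST FRAMING: exact (Metropolis-corrected) sampling algorithms for lattice gauge theory;
figures of merit are autocorrelation/cost numbers at stated couplings and volumes; no
continuum-physics claim.

Venture `LatticeQCDFlow` (cell pub-lqcd), topic `Scoring`; FANOUT row 4 (`s0-u1-b`, GEN-34).
NEW WORK of the cell (classical asymptotics; our formalisation), no definition, nothing cited as a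
fact (Pitman local alternatives / the non-central `χ²` law NAMED ONLY).

WHY (row 4).  `Scoring/KArmHomogeneityCoverage` gives the SIZE of the one-shot `k`-arm test (all
codes with the same centre: probability `→ N^{⊗R}{Σ_{r≠0} z_r² ≤ c}`) and
`Scoring/KArmHomogeneityPower` its consistency (a FIXED discrepancy is detected with probability
`→ 1`); both list the POWER FUNCTION under LOCAL alternatives as not claimed.  This file supplies it.
Setting: `R = n + 2 ≥ 2` codes on their own probability spaces, code `r` printing `Sₖ^r`, `V̂ₖ^r`
(measurable) with `√k (Sₖ^r − a) ⇒ Z_r ∼ N(h_r, s_r)` — i.e. its target is `a + h_r/√k + o(1/√k)`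
in the CLT scale — and `k·V̂ₖ^r → s_r > 0` almost surely; the codes independent (product space).
THEN (**`kArm_homogeneity_localPower`**) for every `c`,
`P(Σ_r (Sₖ^r − m̂ₖ)²/V̂ₖ^r ≤ c) → N(0,1)^{⊗R}{(z_1 + κ)² + Σ_{r ≠ 0,1} z_r² ≤ c}` with
`κ = √(Σ_r (h_r − h̄_w)²/s_r)`, `h̄_w = (Σ_r h_r/s_r)/(Σ_r 1/s_r)` — the non-centrality is the
homogeneity statistic OF THE DRIFTS.  By `Scoring/GaussianShiftedBallMonotone` the limiting
acceptance probability equals the null (nominal) value at `κ = 0`, is NON-INCREASING in `κ` (so it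
is at most the nominal value: **`kArm_homogeneity_localPower_le_null`**), is at most the
one-dimensional window `N(κ,1)([−√c, √c])` (**`kArm_homogeneity_localPower_le_window`**), and
`→ 0` as `κ → ∞`.
Route: the general limit theorem **`kArm_homogeneity_limit`** (any independent limits `Z_r` whose
statistic has no atom at `c`; steps = joint CLT of the columns via
`Scoring/IndependentFamilyJointLimit`, Slutsky with the error-bar vector, exact scale identity
eventually a.s., portmanteau) + the law of the statistic of independent `N(h_r, s_r)`
(**`measure_homogeneity_shifted_preimage_eq`**, from `Scoring/GaussianNoncentralCochranReduction`).

Two arms (§3, **`kArm_homogeneity_localPower_two`**): `κ² = (h₀ − h₁)²/(s₀ + s₁)`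
(`Scoring/KArmHomogeneityPairwise.homogeneity_statistic_fin_two` on the drifts) and the limit
is the window `N(κ,1)([−√c, √c])` of `Scoring/AgreementTestLocalPower` (`z = √c`).

NOT CLAIMED: rates; random/unequal sample sizes per code (same proof along `m_r(k)`); dependent
codes; Anderson's inequality in general; any number of ours.
-/

open MeasureTheory ProbabilityTheory Filter Topology Finset

namespace Summit.Ventures.LatticeQCDFlow.Scoring

open Set WithLp

/-! ## §1 The law of the statistic of independent `N(h_r, s_r)` -/

section ShiftedLaw

variable {R : ℕ} {Ω' : Type*} [MeasurableSpace Ω'] {P' : Measure Ω'} [IsProbabilityMeasure P']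

/-- Independent `Z_r ∼ N(h_r, s_r)` (`s_r > 0`): the standardised vector `((Z_r − h_r)/√s_r)_r` has
law `N(0,1)^{⊗R}`. [ours] -/
theorem hasLaw_standardise_shift_pi {Z : Fin R → Ω' → ℝ} {h s : Fin R → ℝ} (hs : ∀ r, 0 < s r)
    (hZm : ∀ r, Measurable (Z r)) (hZ : ∀ r, HasLaw (Z r) (gaussianReal (h r) (s r).toNNReal) P')
    (hind : iIndepFun Z P') :
    HasLaw (fun ω' (r : Fin R) => (Z r ω' - h r) / Real.sqrt (s r))
      (Measure.pi fun _ : Fin R => gaussianReal 0 1) P' := by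
  have hZ' : ∀ r, HasLaw (fun ω' => Z r ω' - h r) (gaussianReal 0 (s r).toNNReal) P' := by
    intro r
    have h1 := gaussianReal_sub_const (hZ r) (h r)
    rw [sub_self] at h1
    exact h1
  have hind' : iIndepFun (fun r ω' => Z r ω' - h r) P' :=
    hind.comp (fun r x => x - h r) fun r => measurable_id.sub_const _
  exact hasLaw_standardise_pi hs (fun r => (hZm r).sub_const _) hZ' hind'

/-- **THE LAW OF THE STATISTIC UNDER DIFFERENT CENTRES**: for independent `Z_r ∼ N(h_r, s_r)`
(`s_r > 0`, `R = n + 2 ≥ 2`) and every Borel `B`,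
`P'(Σ_r (Z_r − m̂)²/s_r ∈ B) = N(0,1)^{⊗R}{(z_1 + κ)² + Σ_{r ≠ 0,1} z_r² ∈ B}`,
`κ = √(Σ_r (h_r − h̄_w)²/s_r)`. [ours] -/
theorem measure_homogeneity_shifted_preimage_eq {n : ℕ} {Z : Fin (n + 2) → Ω' → ℝ}
    {h s : Fin (n + 2) → ℝ} (hs : ∀ r, 0 < s r) (hZm : ∀ r, Measurable (Z r))
    (hZ : ∀ r, HasLaw (Z r) (gaussianReal (h r) (s r).toNNReal) P') (hind : iIndepFun Z P')
    {B : Set ℝ} (hB : MeasurableSet B) :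
    P' {ω' | ∑ r, (Z r ω' - (∑ j, Z j ω' / s j) / (∑ j, (s j)⁻¹)) ^ 2 / s r ∈ B}
      = (Measure.pi fun _ : Fin (n + 2) => gaussianReal 0 1)
        {z : Fin (n + 2) → ℝ | (z 1 + Real.sqrt (∑ r, (h r - (∑ j, h j / s j) / (∑ j, (s j)⁻¹)) ^ 2
            / s r)) ^ 2 + ∑ r ∈ (univ.erase 0).erase 1, z r ^ 2 ∈ B} := by
  have hlaw := hasLaw_standardise_shift_pi hs hZm hZ hind
  set σ : Fin (n + 2) → ℝ := fun r => Real.sqrt (s r) with hσ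
  have hσpos : ∀ r, 0 < σ r := fun r => Real.sqrt_pos.2 (hs r)
  have hσsq : ∀ r, σ r ^ 2 = s r := fun r => Real.sq_sqrt (hs r).le
  set A : Set (Fin (n + 2) → ℝ) := {z | ∑ i, ((h i + σ i * z i)
      - (∑ j, (h j + σ j * z j) / σ j ^ 2) / (∑ j, (σ j ^ 2)⁻¹)) ^ 2 / σ i ^ 2 ∈ B} with hA
  have hAm : MeasurableSet A := by
    simp only [hA]
    exact (by fun_prop : Measurable fun z : Fin (n + 2) → ℝ => ∑ i, ((h i + σ i * z i)
      - (∑ j, (h j + σ j * z j) / σ j ^ 2) / (∑ j, (σ j ^ 2)⁻¹)) ^ 2 / σ i ^ 2) hB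
  have hpre : {ω' | ∑ r, (Z r ω' - (∑ j, Z j ω' / s j) / (∑ j, (s j)⁻¹)) ^ 2 / s r ∈ B}
      = (fun ω' (r : Fin (n + 2)) => (Z r ω' - h r) / Real.sqrt (s r)) ⁻¹' A := by
    ext ω'
    simp only [hA, Set.mem_setOf_eq, Set.mem_preimage]
    have hx : ∀ r, h r + σ r * ((Z r ω' - h r) / Real.sqrt (s r)) = Z r ω' := fun r => by
      have hsr : Real.sqrt (s r) ≠ 0 := (Real.sqrt_pos.2 (hs r)).ne'
      simp only [hσ]
      field_simp
      ring
    simp only [hx, hσsq]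
  rw [hpre, ← Measure.map_apply_of_aemeasurable hlaw.aemeasurable hAm, hlaw.map_eq, hA,
    pi_gaussianReal_homogeneity_centres_eq_shiftedBall (zero_ne_one) h σ hσpos hB]
  simp only [hσsq]

/-- **No atoms**: for independent `Z_r ∼ N(h_r, s_r)` with `R = n + 2 ≥ 2`,
`P'(Σ_r (Z_r − m̂)²/s_r = c) = 0` for every `c`. [ours] -/
theorem measure_homogeneity_shifted_levelSet_eq_zero {n : ℕ} {Z : Fin (n + 2) → Ω' → ℝ}
    {h s : Fin (n + 2) → ℝ} (hs : ∀ r, 0 < s r) (hZm : ∀ r, Measurable (Z r))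
    (hZ : ∀ r, HasLaw (Z r) (gaussianReal (h r) (s r).toNNReal) P') (hind : iIndepFun Z P')
    (c : ℝ) :
    P' {ω' | ∑ r, (Z r ω' - (∑ j, Z j ω' / s j) / (∑ j, (s j)⁻¹)) ^ 2 / s r = c} = 0 := by
  have h1 := measure_homogeneity_shifted_preimage_eq hs hZm hZ hind (measurableSet_singleton c)
  simp only [Set.mem_singleton_iff] at h1
  rw [h1]
  exact pi_gaussianReal_shiftedBall_levelSet_eq_zero 0 1 _ c

end ShiftedLaw

/-! ## §2 The general limit theorem and the local power -/

section LocalPower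

variable {n : ℕ} {Ωs : Fin (n + 2) → Type*} [∀ r, MeasurableSpace (Ωs r)]
  {Ps : (r : Fin (n + 2)) → Measure (Ωs r)} [∀ r, IsProbabilityMeasure (Ps r)]
variable {Ω' : Type*} [MeasurableSpace Ω'] {P' : Measure Ω'} [IsProbabilityMeasure P']

set_option maxHeartbeats 400000 in
/-- **THE GENERAL LIMIT THEOREM FOR THE `k`-ARM STATISTIC.**  `R = n + 2 ≥ 2` codes, code `r`
printing on its own probability space `Sₖ^r`, `V̂ₖ^r` (measurable) with `√k(Sₖ^r − a) ⇒ Z_r` for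
SOME independent family of real limits `(Z_r)` (measurable), `k·V̂ₖ^r → s_r > 0` almost surely.  If
the limit statistic `Σ_r (Z_r − m̂)²/s_r` has no atom at `c`, then on `⊗_r P_r` the probability that
the inverse-variance homogeneity statistic is `≤ c` tends to `P'(Σ_r (Z_r − m̂)²/s_r ≤ c)`. [ours] -/
theorem kArm_homogeneity_limit {S V : (r : Fin (n + 2)) → ℕ → Ωs r → ℝ} {a : ℝ}
    {s : Fin (n + 2) → ℝ} {Z : Fin (n + 2) → Ω' → ℝ} (hs : ∀ r, 0 < s r)
    (hSm : ∀ r k, Measurable (S r k)) (hVm : ∀ r k, Measurable (V r k))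
    (hclt : ∀ r, TendstoInDistribution (fun (k : ℕ) ω => Real.sqrt k * (S r k ω - a)) atTop (Z r)
      (fun _ => Ps r) P')
    (hZm : ∀ r, Measurable (Z r)) (hind : iIndepFun Z P')
    (hV : ∀ r, ∀ᵐ ω ∂(Ps r), Tendsto (fun k : ℕ => (k : ℝ) * V r k ω) atTop (𝓝 (s r))) {c : ℝ}
    (hatom : P' {ω' | ∑ r, (Z r ω' - (∑ j, Z j ω' / s j) / (∑ j, (s j)⁻¹)) ^ 2 / s r = c} = 0) :
    Tendsto (fun k : ℕ => (Measure.pi Ps).real {ω : (r : Fin (n + 2)) → Ωs r |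
        ∑ r, (S r k (ω r) - (∑ j, S j k (ω j) / V j k (ω j)) / (∑ j, (V j k (ω j))⁻¹)) ^ 2
          / V r k (ω r) ≤ c})
      atTop (𝓝 (P'.real {ω' | ∑ r, (Z r ω' - (∑ j, Z j ω' / s j) / (∑ j, (s j)⁻¹)) ^ 2 / s r ≤ c})) := by
  -- the clamp
  set m₀ : ℝ := (Finset.univ.inf' Finset.univ_nonempty s) / 2 with hm₀
  have hinf : 0 < Finset.univ.inf' Finset.univ_nonempty s :=
    (Finset.lt_inf'_iff _).2 fun r _ => hs r
  have hm0 : 0 < m₀ := by rw [hm₀]; exact half_pos hinf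
  have hm_le : ∀ r, m₀ < s r := fun r => by
    have : Finset.univ.inf' Finset.univ_nonempty s ≤ s r := Finset.inf'_le _ (Finset.mem_univ r)
    rw [hm₀]; linarith
  -- Step 1: joint convergence of the scaled columns and of the error-bar vector
  have hXm : ∀ r (k : ℕ), Measurable fun ω : Ωs r => Real.sqrt (k : ℝ) * (S r k ω - a) :=
    fun r k => ((hSm r k).sub_const a).const_mul _
  have hY := CardConsistency.tendstoInDistribution_replicas (Ps := Ps) hclt hXm hZm hind
  have hWm : ∀ k : ℕ, Measurable fun (ω : (r : Fin (n + 2)) → Ωs r) (r : Fin (n + 2)) =>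
      ((k : ℕ) : ℝ) * V r k (ω r) :=
    fun k => measurable_pi_lambda _ fun r => ((hVm r k).comp (measurable_pi_apply r)).const_mul _
  have hae : ∀ᵐ ω ∂(Measure.pi Ps), ∀ r, Tendsto (fun k : ℕ => (k : ℝ) * V r k (ω r)) atTop (𝓝 (s r)) := by
    rw [ae_all_iff]
    intro r
    exact (Measure.quasiMeasurePreserving_eval Ps r).ae (hV r)
  have hWm' : ∀ k : ℕ, Measurable fun (ω : (r : Fin (n + 2)) → Ωs r) =>
      (toLp 2 (fun r : Fin (n + 2) => ((k : ℕ) : ℝ) * V r k (ω r)) : EuclideanSpace ℝ (Fin (n + 2))) :=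
    fun k => (WithLp.measurable_toLp 2 _).comp (hWm k)
  have hW : TendstoInMeasure (Measure.pi Ps) (fun (k : ℕ) (ω : (r : Fin (n + 2)) → Ωs r) =>
      (toLp 2 (fun r : Fin (n + 2) => ((k : ℕ) : ℝ) * V r k (ω r)) : EuclideanSpace ℝ (Fin (n + 2))))
      atTop (fun _ => (toLp 2 s : EuclideanSpace ℝ (Fin (n + 2)))) := by
    refine tendstoInMeasure_of_tendsto_ae (fun k => (hWm' k).aestronglyMeasurable) ?_
    filter_upwards [hae] with ω hω
    exact ((PiLp.continuous_toLp 2 (fun _ : Fin (n + 2) => ℝ)).tendsto s).comp (tendsto_pi_nhds.2 hω)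
  -- Step 2: Slutsky with the clamped functional `F`
  set F : EuclideanSpace ℝ (Fin (n + 2)) × EuclideanSpace ℝ (Fin (n + 2)) → ℝ := fun p =>
    ∑ r, (p.1 r - (∑ j, p.1 j / max (p.2 j) m₀) / (∑ j, (max (p.2 j) m₀)⁻¹)) ^ 2 / max (p.2 r) m₀
    with hF
  have hgc : Continuous F := continuous_homogeneityClamp (R := n + 2) hm0
  have hsl := hY.continuous_comp_prodMk_of_tendstoInMeasure_const hgc hW (fun k => (hWm' k).aemeasurable)
  have hlim : (fun ω' => F ((toLp 2 fun r => Z r ω' : EuclideanSpace ℝ (Fin (n + 2))),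
        (toLp 2 s : EuclideanSpace ℝ (Fin (n + 2)))))
      = fun ω' => ∑ r, (Z r ω' - (∑ j, Z j ω' / s j) / (∑ j, (s j)⁻¹)) ^ 2 / s r := by
    funext ω'
    simp only [hF, max_eq_left (hm_le _).le]
  rw [hlim] at hsl
  -- Step 3: the printed statistic agrees with the clamped functional eventually, almost surely
  have hQm : ∀ k : ℕ, Measurable fun ω : (r : Fin (n + 2)) → Ωs r =>
      ∑ r, (S r k (ω r) - (∑ j, S j k (ω j) / V j k (ω j)) / (∑ j, (V j k (ω j))⁻¹)) ^ 2
        / V r k (ω r) := by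
    intro k
    have h1 : ∀ r, Measurable fun ω : (r : Fin (n + 2)) → Ωs r => S r k (ω r) :=
      fun r => (hSm r k).comp (measurable_pi_apply r)
    have h2 : ∀ r, Measurable fun ω : (r : Fin (n + 2)) → Ωs r => V r k (ω r) :=
      fun r => (hVm r k).comp (measurable_pi_apply r)
    fun_prop
  have hPm : ∀ k : ℕ, Measurable fun ω : (r : Fin (n + 2)) → Ωs r =>
      ((toLp 2 fun r => Real.sqrt (k : ℝ) * (S r k (ω r) - a) : EuclideanSpace ℝ (Fin (n + 2))),
        (toLp 2 (fun r : Fin (n + 2) => ((k : ℕ) : ℝ) * V r k (ω r)) : EuclideanSpace ℝ (Fin (n + 2)))) :=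
    fun k => ((WithLp.measurable_toLp 2 _).comp (measurable_pi_lambda _ fun r =>
      (hXm r k).comp (measurable_pi_apply r))).prodMk (hWm' k)
  have hdev : TendstoInMeasure (Measure.pi Ps) ((fun (k : ℕ) (ω : (r : Fin (n + 2)) → Ωs r) =>
      ∑ r, (S r k (ω r) - (∑ j, S j k (ω j) / V j k (ω j)) / (∑ j, (V j k (ω j))⁻¹)) ^ 2
        / V r k (ω r)) - fun (k : ℕ) ω =>
      F ((toLp 2 fun r => Real.sqrt (k : ℝ) * (S r k (ω r) - a) : EuclideanSpace ℝ (Fin (n + 2))),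
        (toLp 2 (fun r : Fin (n + 2) => ((k : ℕ) : ℝ) * V r k (ω r)) : EuclideanSpace ℝ (Fin (n + 2)))))
      atTop 0 := by
    refine tendstoInMeasure_of_tendsto_ae
      (fun k => ((hQm k).sub (hgc.measurable.comp (hPm k))).aestronglyMeasurable) ?_
    filter_upwards [hae] with ω hω
    have hev : ∀ᶠ k : ℕ in atTop, ∀ r, m₀ < ((k : ℕ) : ℝ) * V r k (ω r) :=
      eventually_all.2 fun r => (hω r).eventually_const_lt (hm_le r)
    refine (tendsto_const_nhds (x := (0 : ℝ))).congr' ?_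
    filter_upwards [hev, eventually_ge_atTop 1] with k hk hk1
    have hVpos : ∀ r, 0 < V r k (ω r) := fun r => by
      have := hk r
      nlinarith [hm0]
    simp only [Pi.sub_apply, hF, max_eq_left (hk _).le]
    rw [homogeneity_statistic_scale hk1 (fun r => S r k (ω r)) (fun r => V r k (ω r)) hVpos a]
    ring
  have hQ := tendstoInDistribution_of_tendstoInMeasure_sub _ _ hsl hdev (fun k => (hQm k).aemeasurable)
  -- Step 4: portmanteau on the continuity set `{· ≤ c}`
  have hLm : Measurable fun ω' => ∑ r, (Z r ω' - (∑ j, Z j ω' / s j) / (∑ j, (s j)⁻¹)) ^ 2 / s r := by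
    fun_prop
  have hfr : (P'.map fun ω' => ∑ r, (Z r ω' - (∑ j, Z j ω' / s j) / (∑ j, (s j)⁻¹)) ^ 2 / s r)
      (frontier (Iic c)) = 0 := by
    rw [frontier_Iic, Measure.map_apply hLm (measurableSet_singleton c)]
    exact hatom
  exact CardConsistency.tendsto_measureReal_preimage_of_tendstoInDistribution hQ measurableSet_Iic hfr

/-- **THE LOCAL POWER OF THE `k`-ARM HOMOGENEITY TEST.**  `R = n + 2 ≥ 2` codes, code `r` printing
on its own probability space `Sₖ^r`, `V̂ₖ^r` (measurable) with `√k(Sₖ^r − a) ⇒ Z_r ∼ N(h_r, s_r)`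
(`s_r > 0`; centre `a + h_r/√k` in the CLT scale) and `k·V̂ₖ^r → s_r` almost surely; `(Z_r)`
independent.  Then on `⊗_r P_r`, for every `c`,
`P(Σ_r (Sₖ^r − m̂ₖ)²/V̂ₖ^r ≤ c) → N(0,1)^{⊗R}{(z_1 + κ)² + Σ_{r ≠ 0,1} z_r² ≤ c}`,
`κ = √(Σ_r (h_r − h̄_w)²/s_r)` (textbook: `P(χ²_{R−1}(κ²) ≤ c)`). [ours] -/
theorem kArm_homogeneity_localPower {S V : (r : Fin (n + 2)) → ℕ → Ωs r → ℝ} {a : ℝ}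
    {h s : Fin (n + 2) → ℝ} {Z : Fin (n + 2) → Ω' → ℝ} (hs : ∀ r, 0 < s r)
    (hSm : ∀ r k, Measurable (S r k)) (hVm : ∀ r k, Measurable (V r k))
    (hclt : ∀ r, TendstoInDistribution (fun (k : ℕ) ω => Real.sqrt k * (S r k ω - a)) atTop (Z r)
      (fun _ => Ps r) P')
    (hZm : ∀ r, Measurable (Z r)) (hZ : ∀ r, HasLaw (Z r) (gaussianReal (h r) (s r).toNNReal) P')
    (hind : iIndepFun Z P')
    (hV : ∀ r, ∀ᵐ ω ∂(Ps r), Tendsto (fun k : ℕ => (k : ℝ) * V r k ω) atTop (𝓝 (s r))) (c : ℝ) :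
    Tendsto (fun k : ℕ => (Measure.pi Ps).real {ω : (r : Fin (n + 2)) → Ωs r |
        ∑ r, (S r k (ω r) - (∑ j, S j k (ω j) / V j k (ω j)) / (∑ j, (V j k (ω j))⁻¹)) ^ 2
          / V r k (ω r) ≤ c})
      atTop (𝓝 ((Measure.pi fun _ : Fin (n + 2) => gaussianReal 0 1).real
        {z : Fin (n + 2) → ℝ | (z 1 + Real.sqrt (∑ r, (h r - (∑ j, h j / s j) / (∑ j, (s j)⁻¹)) ^ 2
            / s r)) ^ 2 + ∑ r ∈ (univ.erase 0).erase 1, z r ^ 2 ≤ c})) := by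
  have hconv := kArm_homogeneity_limit hs hSm hVm hclt hZm hind hV
    (measure_homogeneity_shifted_levelSet_eq_zero hs hZm hZ hind c)
  have hlimit : P'.real {ω' | ∑ r, (Z r ω' - (∑ j, Z j ω' / s j) / (∑ j, (s j)⁻¹)) ^ 2 / s r ≤ c}
      = (Measure.pi fun _ : Fin (n + 2) => gaussianReal 0 1).real
        {z : Fin (n + 2) → ℝ | (z 1 + Real.sqrt (∑ r, (h r - (∑ j, h j / s j) / (∑ j, (s j)⁻¹)) ^ 2
            / s r)) ^ 2 + ∑ r ∈ (univ.erase 0).erase 1, z r ^ 2 ≤ c} := by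
    simp only [measureReal_def]
    congr 1
    exact measure_homogeneity_shifted_preimage_eq hs hZm hZ hind measurableSet_Iic
  rw [hlimit] at hconv
  exact hconv

/-- **The limiting ACCEPTANCE probability under local alternatives is AT MOST the null (nominal)
one**: the shifted-ball probability is maximal at `κ = 0`, where it is the central functional of
`Scoring/KArmHomogeneityCoverage` (the test is asymptotically unbiased). [ours] -/
theorem kArm_homogeneity_localPower_le_null (h s : Fin (n + 2) → ℝ) (c : ℝ) :
    (Measure.pi fun _ : Fin (n + 2) => gaussianReal 0 1).real
        {z : Fin (n + 2) → ℝ | (z 1 + Real.sqrt (∑ r, (h r - (∑ j, h j / s j) / (∑ j, (s j)⁻¹)) ^ 2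
            / s r)) ^ 2 + ∑ r ∈ (univ.erase 0).erase 1, z r ^ 2 ≤ c}
      ≤ (Measure.pi fun _ : Fin (n + 2) => gaussianReal 0 1).real
        {z : Fin (n + 2) → ℝ | ∑ r ∈ univ.erase 0, z r ^ 2 ≤ c} := by
  set K := ∑ r, (h r - (∑ j, h j / s j) / (∑ j, (s j)⁻¹)) ^ 2 / s r with hK
  have h0 := pi_gaussianReal_shiftedBall_antitoneOn (ι := Fin (n + 2)) 0 1 c
    (Set.mem_Ici.2 (le_refl (0 : ℝ))) (Set.mem_Ici.2 (Real.sqrt_nonneg K)) (Real.sqrt_nonneg K)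
  rw [← shiftedBall_zero_eq_erase (zero_ne_one : (0 : Fin (n + 2)) ≠ 1) c]
  exact h0

/-- **The limiting acceptance probability is at most the one-dimensional window
`N(κ,1)([−√c, √c])`** of `Scoring/AgreementTestLocalPower` (`c ≥ 0`), which `→ 0` as `κ → ∞`. [ours] -/
theorem kArm_homogeneity_localPower_le_window (h s : Fin (n + 2) → ℝ) {c : ℝ} (hc : 0 ≤ c) :
    (Measure.pi fun _ : Fin (n + 2) => gaussianReal 0 1).real
        {z : Fin (n + 2) → ℝ | (z 1 + Real.sqrt (∑ r, (h r - (∑ j, h j / s j) / (∑ j, (s j)⁻¹)) ^ 2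
            / s r)) ^ 2 + ∑ r ∈ (univ.erase 0).erase 1, z r ^ 2 ≤ c}
      ≤ (gaussianReal (Real.sqrt (∑ r, (h r - (∑ j, h j / s j) / (∑ j, (s j)⁻¹)) ^ 2 / s r)) 1).real
        (Icc (-Real.sqrt c) (Real.sqrt c)) := by
  have h1 := pi_gaussianReal_shiftedBall_le_marginal (ι := Fin (n + 2)) 0 1
    (Real.sqrt (∑ r, (h r - (∑ j, h j / s j) / (∑ j, (s j)⁻¹)) ^ 2 / s r)) c
  rw [gaussianReal_sqShift_le_eq hc] at h1
  simp only [measureReal_def]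
  exact (ENNReal.toReal_le_toReal (measure_ne_top _ _) (measure_ne_top _ _)).2 h1

end LocalPower

/-! ## §3 Two arms: the `k`-arm local power IS the pairwise local power -/

section TwoArms

variable {Ωs : Fin 2 → Type*} [∀ r, MeasurableSpace (Ωs r)]
  {Ps : (r : Fin 2) → Measure (Ωs r)} [∀ r, IsProbabilityMeasure (Ps r)]
variable {Ω' : Type*} [MeasurableSpace Ω'] {P' : Measure Ω'} [IsProbabilityMeasure P']

/-- **Two arms**: with `√k(Sₖ^A − a) ⇒ N(h₀, s₀)`, `√k(Sₖ^B − a) ⇒ N(h₁, s₁)`, consistent error bars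
and independent codes, `P((Sₖ^A − m̂ₖ)²/V̂ₖ^A + (Sₖ^B − m̂ₖ)²/V̂ₖ^B ≤ c) → N(κ,1)([−√c, √c])`,
`κ = √((h₀ − h₁)²/(s₀ + s₁))` (`c ≥ 0`) — the `k`-arm local power at `R = 2` is the window
probability of `Scoring/AgreementTestLocalPower` at `z = √c` and drift `κ` true combined standard
errors (the two-arm homogeneity statistic being the SQUARE of the `σ_comb` statistic,
`Scoring/KArmHomogeneityPairwise`). [ours] -/
theorem kArm_homogeneity_localPower_two {S V : (r : Fin 2) → ℕ → Ωs r → ℝ} {a : ℝ}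
    {h s : Fin 2 → ℝ} {Z : Fin 2 → Ω' → ℝ} (hs : ∀ r, 0 < s r)
    (hSm : ∀ r k, Measurable (S r k)) (hVm : ∀ r k, Measurable (V r k))
    (hclt : ∀ r, TendstoInDistribution (fun (k : ℕ) ω => Real.sqrt k * (S r k ω - a)) atTop (Z r)
      (fun _ => Ps r) P')
    (hZm : ∀ r, Measurable (Z r)) (hZ : ∀ r, HasLaw (Z r) (gaussianReal (h r) (s r).toNNReal) P')
    (hind : iIndepFun Z P')
    (hV : ∀ r, ∀ᵐ ω ∂(Ps r), Tendsto (fun k : ℕ => (k : ℝ) * V r k ω) atTop (𝓝 (s r))) {c : ℝ}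
    (hc : 0 ≤ c) :
    Tendsto (fun k : ℕ => (Measure.pi Ps).real {ω : (r : Fin 2) → Ωs r |
        ∑ r, (S r k (ω r) - (∑ j, S j k (ω j) / V j k (ω j)) / (∑ j, (V j k (ω j))⁻¹)) ^ 2
          / V r k (ω r) ≤ c})
      atTop (𝓝 ((gaussianReal (Real.sqrt ((h 0 - h 1) ^ 2 / (s 0 + s 1))) 1).real
        (Icc (-Real.sqrt c) (Real.sqrt c)))) := by
  have hconv := kArm_homogeneity_localPower (n := 0) hs hSm hVm hclt hZm hZ hind hV c
  -- for two arms the non-centrality is `(h₀ − h₁)²/(s₀ + s₁)`: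
  -- `Scoring/KArmHomogeneityPairwise.homogeneity_statistic_fin_two` applied to the drifts
  rw [homogeneity_statistic_fin_two h s hs, pi_gaussianReal_shiftedBall_fin_two hc] at hconv
  exact hconv

end TwoArms

end Summit.Ventures.LatticeQCDFlow.Scoring
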